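import Summits.PneNP.PneNP.Theorems.Capture.Negative.LoadBearing
import Literature.Computability.Complexity.CircuitClassesProofs
import HarnessLib

/-!
# Crux `Capture` (stmt-PneNP-2659) — duality audit, transfer lemma and the DUAL-PERM door test

The Boolean dual of `g : {0,1}^ι → {0,1}` is `g^d(x) = ¬ g(¬ x)`. If `g` is monotone so is `g^d`, and a
`B₂`-circuit for `g` of size `t` gives one for `g^d` of size `t + |ι| + 1` (negate the inputs and the
output). Hence the crux `Capture` TRANSFERS TO DUALS (`capture_bdual`): under `Capture`, the dual of every
monotone function with a small `B₂`-circuit has a polynomial extended monotone circuit — in particular the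
dual of every TAME gate of the extended basis (a gate whose own function has polynomial `B₂`-circuits).
Read gate class by gate class this is the DUALITY AUDIT of the crux: `AND/OR` (trivial), CONV (LP slice:
Farkas; SDP slice: open, closedness), abelian PERM (span-program duality, `ConvexRankGatesCaptureDualSpan`),
transversal GRANK (König, `ConvexRankGatesCaptureDualBpm`) pass; the NONABELIAN PERM cell is the crisp open
door test isolated here (`capture_imp_dualPerm`): permutation-group membership is decidable in polynomial
time (Sims 1970; Furst–Hopcroft–Luks 1980, Thm. 1), so PERM gates are tame, and `Capture` then forces

  `DualPerm(σ, τ) : v ↦ [τ ∉ ⟨σ i : v i = 0⟩]`   (non-membership in the group generated by the UNselected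
                                                  permutations)

to have extended monotone circuits of size polynomial in `n + d`. No such circuits are known for
nonabelian generators (the meet side of the csp-spine line in gate form); a lower bound against them would
refute `Capture` and hence, by the Valiant barrier (`notCaptureImpValiant`), prove `VBP ≠ VNP`.
The tameness hypothesis is written inline as an explicit polynomial-size `B₂`-circuit family for
membership (the non-uniform shadow of FHL 1980 Thm. 1 via `P ⊆ P/poly`); it is a hypothesis of the
theorem, not a claim of this file. [folklore]
-/

namespace Summit.PneNP.PneNP.Theorems.Capture.DualityAudit

set_option linter.dupNamespace false -- `Summit.PneNP.PneNP.…`: summit = sub-problem (D-0017)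

open scoped Classical
open Literature.Computability.Complexity
open Summit.PneNP.PneNP.Theses.ConvexRankGates (Capture)
open Summit.PneNP.PneNP.Theorems.Capture.Negative (CaptureInto capture_iff)

/-- The Boolean dual `x ↦ ¬ g (¬ x)` of a monotone function is monotone. [folklore] -/
theorem monotone_bdual {ι : Type*} {g : (ι → Bool) → Bool} (hg : Monotone g) :
    Monotone fun x : ι → Bool => !g (fun i => !x i) := by
  intro x y hxy
  have h : (fun i => !y i) ≤ fun i => !x i := fun i => by
    show (!y i) ≤ !x i
    have hi : x i ≤ y i := hxy i
    revert hi
    rcases Bool.eq_false_or_eq_true (x i) with hx | hx <;>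
      rcases Bool.eq_false_or_eq_true (y i) with hy | hy <;> rw [hx, hy] <;> decide
  show (!g fun i => !x i) ≤ !g fun i => !y i
  have hgh := hg h
  revert hgh
  rcases Bool.eq_false_or_eq_true (g fun i => !y i) with h1 | h1 <;>
    rcases Bool.eq_false_or_eq_true (g fun i => !x i) with h2 | h2 <;> rw [h1, h2] <;> decide

/-- **Dualising a `B₂`-circuit costs `|ι| + 1` gates**: negate every input, run the circuit, negate the
output (Vollmer 1999, §1.2, projection/negation closure). [folklore] -/
theorem exists_circuit_bdual {ι : Type*} [Fintype ι] (C : Circuit ι) (hC : C.IsOver B2) :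
    ∃ C' : Circuit ι, C'.IsOver B2 ∧ C'.size ≤ C.size + Fintype.card ι + 1 ∧
      C'.Computes fun x => !C.eval (fun i => !x i) := by
  have h1 : CktSize B2 (fun (x : ι → Bool) (i : ι) => !x i) (Fintype.card ι * 1) :=
    CktSize.pi_const fun i => cktSize_not i
  have h2 : CktSize B2 (fun (x : ι → Bool) (_ : Unit) => C.eval fun i => !x i)
      (Fintype.card ι * 1 + C.size) :=
    h1.comp (Circuit.cktSize_eval C hC)
  have h3 : CktSize B2 (fun (x : ι → Bool) (_ : Unit) => !C.eval fun i => !x i)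
      (Fintype.card ι * 1 + C.size + 1) :=
    h2.comp (cktSize_not (ι := Unit) ())
  obtain ⟨C', hC', hs, he⟩ := (h3.of_le (s' := C.size + Fintype.card ι + 1) (by omega)).toCircuit
  exact ⟨C', hC', hs, fun x => he x⟩

/-- **`Capture` transfers to Boolean duals** (the duality audit in one line): under the crux, the dual
`x ↦ ¬ g (¬ x)` of every monotone `g` with a `B₂`-circuit `C` has an extended monotone circuit of size
`≤ (|C| + 2|ι| + 3)^a` over `B_{(|C| + 2|ι| + 3)^a}`, with the exponent `a` of `Capture`. [folklore] -/
theorem capture_bdual : Summit.PneNP.PneNP.Theses.ConvexRankGates.Capture → ∃ a : ℕ, ∀ (ι : Type) (_ : Fintype ι)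
    (g : (ι → Bool) → Bool), Monotone g → ∀ C : Circuit ι, C.IsOver B2 → C.Computes g →
      ∃ C' : Circuit ι, C'.IsOver (extGate ((C.size + 2 * Fintype.card ι + 3) ^ a)) ∧
        C'.size ≤ (C.size + 2 * Fintype.card ι + 3) ^ a ∧ C'.Computes fun x => !g (fun i => !x i) := by
  intro hCap
  obtain ⟨a, hcap⟩ := capture_iff.1 hCap
  refine ⟨a, fun ι _ g hg C hC hCg => ?_⟩
  obtain ⟨D, hD, hDs, hDe⟩ := exists_circuit_bdual C hC
  have hDg : D.Computes fun x => !g (fun i => !x i) := fun x =>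
    (hDe x).trans (by simp only [hCg (fun i => !x i)])
  obtain ⟨C', hC'over, hC'size, hC'comp⟩ := hcap ι inferInstance _ (monotone_bdual hg) D hD hDg
  have hle : D.size + Fintype.card ι + 2 ≤ C.size + 2 * Fintype.card ι + 3 := by omega
  exact ⟨C', hC'over.mono (extGate_mono (Nat.pow_le_pow_left hle a)),
    hC'size.trans (Nat.pow_le_pow_left hle a), hC'comp⟩

/-- Exponent bookkeeping: `N^c + 2n + 3 ≤ N^(c+3)` for `N = n + d + 2`. [folklore] -/
theorem pow_add_le_pow (n d c : ℕ) : (n + d + 2) ^ c + 2 * n + 3 ≤ (n + d + 2) ^ (c + 3) := by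
  set N := n + d + 2 with hN
  have hN2 : 2 ≤ N := by omega
  have h1 : 1 ≤ N ^ c := Nat.one_le_pow _ _ (by omega)
  have h3 : 2 * N + 1 ≤ N ^ 3 := by
    have : 2 * 2 * N ≤ N * N * N := by gcongr
    calc 2 * N + 1 ≤ 2 * 2 * N := by omega
      _ ≤ N * N * N := this
      _ = N ^ 3 := by ring
  have h4 : 2 * n + 3 ≤ 2 * N := by omega
  calc N ^ c + 2 * n + 3 ≤ N ^ c + 2 * N := by omega
    _ ≤ N ^ c * N ^ 3 := by nlinarith [h1, h3]
    _ = N ^ (c + 3) := by rw [pow_add]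

/-- **The DUAL-PERM door test, kernel form** (registered sub-goal `capture_imp_dualPerm`). Hypotheses:
the crux `Capture`, and TAMENESS of PERM gates — every membership function
`v ↦ [τ ∈ ⟨σ i : v i = 1⟩]` (`σ i, τ ∈ Sym(Fin d)`, arity `n`) has a `B₂`-circuit of size
`≤ (n + d + 2)^c` for one absolute `c` (the non-uniform shadow of Sims 1970 / Furst–Hopcroft–Luks 1980,
Thm. 1: membership in permutation groups is in `P`, and `P ⊆ P/poly`). Conclusion: the dual door
`v ↦ [τ ∉ ⟨σ i : v i = 0⟩]` has extended monotone circuits of size `≤ (n + d + 2)^c'` over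
`B_{(n+d+2)^c'}` for one absolute `c'`. A superpolynomial lower bound for this explicit monotone `P`-family
against extended circuits would refute `Capture` (and so prove `VBP ≠ VNP`, `notCaptureImpValiant`); a
polynomial upper bound for nonabelian generators is not known. [folklore] -/
theorem capture_imp_dualPerm : Summit.PneNP.PneNP.Theses.ConvexRankGates.Capture →
    (∃ c : ℕ, ∀ (d n : ℕ) (σ : Fin n → Equiv.Perm (Fin d)) (τ : Equiv.Perm (Fin d)),
      ∃ C : Circuit (Fin n), C.IsOver B2 ∧ C.size ≤ (n + d + 2) ^ c ∧
        C.Computes fun v => decide (τ ∈ Subgroup.closure (σ '' {i | v i = true}))) →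
    ∃ c : ℕ, ∀ (d n : ℕ) (σ : Fin n → Equiv.Perm (Fin d)) (τ : Equiv.Perm (Fin d)),
      ∃ C : Circuit (Fin n), C.IsOver (extGate ((n + d + 2) ^ c)) ∧ C.size ≤ (n + d + 2) ^ c ∧
        C.Computes fun v => decide (τ ∉ Subgroup.closure (σ '' {i | v i = false})) := by
  intro hCap hFHL
  obtain ⟨a, hdual⟩ := capture_bdual hCap
  obtain ⟨c, hc⟩ := hFHL
  refine ⟨(c + 3) * a, fun d n σ τ => ?_⟩
  obtain ⟨C, hC, hCs, hCe⟩ := hc d n σ τ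
  have hmono : Monotone fun v : Fin n → Bool =>
      decide (τ ∈ Subgroup.closure (σ '' {i | v i = true})) := by
    intro v w hvw
    apply Bool.le_iff_imp.2
    simp only [decide_eq_true_eq]
    intro h
    refine Subgroup.closure_mono (Set.image_mono fun i (hi : v i = true) => ?_) h
    have := hvw i
    rw [hi] at this
    exact top_le_iff.1 this
  obtain ⟨C', hC'o, hC's, hC'c⟩ := hdual (Fin n) inferInstance _ hmono C hC hCe
  -- size bookkeeping: `(|C| + 2n + 3)^a ≤ (n + d + 2)^((c+3) a)`
  have hN : C.size + 2 * Fintype.card (Fin n) + 3 ≤ (n + d + 2) ^ (c + 3) := by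
    rw [Fintype.card_fin]
    exact le_trans (by omega) (pow_add_le_pow n d c)
  have hpow : (C.size + 2 * Fintype.card (Fin n) + 3) ^ a ≤ (n + d + 2) ^ ((c + 3) * a) := by
    rw [pow_mul]
    exact Nat.pow_le_pow_left hN a
  refine ⟨C', hC'o.mono (extGate_mono hpow), hC's.trans hpow, fun v => ?_⟩
  rw [hC'c v, Bool.eq_iff_iff]
  simp only [Bool.not_eq_true', decide_eq_false_iff_not, decide_eq_true_eq]

end Summit.PneNP.PneNP.Theorems.Capture.DualityAudit
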